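import Mathlib
import HarnessLib.Audit
import Summits.PneNP.PneNP.Theorems.PstarSlackOneCentre

/-!
# Slack accounting tools II: inside gates, four fat chords, families on three vertices (ROUND-24, O1; memo g25 §49)

FRONTIER range-avoidance ladder, rung F-N3, ROUND 24 (cell `pnp-ideate`, prover-2 memo `g25/O1-XORSPLIT-g25.md` §49; typed targets
`PstarCoreBoundTargets.TerminalFive` / `TerminalPeelable` (p646951); restricted-model proof complexity — nothing here bears on `P` versus `NP`).

Lemmas for the slack-two layer with a dirty chord (`PstarSlackTwoDirty`):
* `exists_inside_gate` — a dirty chord `d` of a terminal core carries an INSIDE monomial `g`: `g ∉ K`, both AND variables of `g` are read by `K`,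
  and `g` reads a private of `d` (a boundary variable of `K`); `not_mem_varSet_gate_of_clean` — such a `g` reads no AND slot of a clean chord;
* `card_bdry_insert_le_two` — inserting an output reading two distinct boundary variables (AND variables read by `K`) does not raise `#bdry`;
* `card_deg2_chords_le_filter` — the degree-two injection of `PstarSlackTools` lands in the degree-two vertices off the centre;
* `false_of_four_fat` — four distinct clean chords pairwise sharing endpoints of degree three are impossible in a covered family;
* `card_le_three_of_xpairs_subset` — at most three members of a simple-overlap family have both XOR variables in a given three-element set.
-/

set_option linter.dupNamespace false -- `Summit.PneNP.PneNP.…`: summit = sub-problem name (D-0017 single-conjunct layout)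

open Finset Literature.Computability.Complexity
open Summit.PneNP.PneNP.Theorems.PstarTyped (Typed)
open Summit.PneNP.PneNP.Theorems.PstarSALevel (varSet bdry BoundaryExpanding SimpleOverlap)
open Summit.PneNP.PneNP.Theorems.PstarSAClosure (degIn mem_bdry_iff)
open Summit.PneNP.PneNP.Theorems.PstarXCore (xpair mem_xpair xverts)
open Summit.PneNP.PneNP.Theorems.PstarCentreFree (vars_mem_varSet)
open Summit.PneNP.PneNP.Theorems.PstarCoreBound (XorClosed)
open Summit.PneNP.PneNP.Theorems.PstarChordRepair (IsChord)
open Summit.PneNP.PneNP.Theorems.PstarCoreBoundTargets (Terminal)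
open Summit.PneNP.PneNP.Theorems.PstarChordBridgeTools (xpdeg)
open Summit.PneNP.PneNP.Theorems.PstarChordBridgeExchange (mem_xverts_iff)
open Summit.PneNP.PneNP.Theorems.PstarNorUnitCoverTools (exists_ne_of_two_le_xpdeg)
open Summit.PneNP.PneNP.Theorems.PstarChordReadSwitches (Touches)
open Summit.PneNP.PneNP.Theorems.PstarChordReadOutside (OutsideGated IsGate touches_of_slot)
open Summit.PneNP.PneNP.Theorems.PstarNoFreeVertex (Covered mem_varSet_of_mem_xpair)
open Summit.PneNP.PneNP.Theorems.PstarSkeletonSpan (xverts_mono)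
open Summit.PneNP.PneNP.Theorems.PstarMaxSharingCentre (degIn_erase)
open Summit.PneNP.PneNP.Theorems.PstarSlackTools (degIn_insert two_le_degIn)

namespace Summit.PneNP.PneNP.Theorems.PstarSlackTwoTools

variable {n m : ℕ}

/-! ## The inside gate of a dirty chord -/

/-- **A dirty chord carries an inside monomial**: for a chord `d ∈ K` that is not outside-gated (menu `M` disjoint from `K`) there is `g ∈ M`,
`g ∉ K`, both of whose AND variables are read by members of `K`, reading a private of `d`. -/
theorem exists_inside_gate (I : LocalMap 4 n m) {K M : Finset (Fin m)} (hKM : Disjoint K M) {d : Fin m} (hd : d ∈ K) (hch : IsChord I K d)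
    (hdirty : ¬ OutsideGated I K M d) :
    ∃ g ∈ M, g ∉ K ∧ (∃ j ∈ K, I.vars g 2 ∈ varSet I j) ∧ (∃ j ∈ K, I.vars g 3 ∈ varSet I j) ∧
      ∃ v, (v = I.vars d 2 ∨ v = I.vars d 3) ∧ v ∈ varSet I g ∧ v ∈ bdry I K := by
  classical
  unfold PstarChordReadOutside.OutsideGated at hdirty
  push Not at hdirty
  obtain ⟨g, hgM, htouch, hnogate⟩ := hdirty
  have hgK : g ∉ K := fun h => disjoint_left.1 hKM h hgM
  have slot : ∃ v z : Fin n, (v = I.vars d 2 ∨ v = I.vars d 3) ∧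
      ((I.vars g 2 = v ∧ I.vars g 3 = z) ∨ (I.vars g 2 = z ∧ I.vars g 3 = v)) := by
    unfold PstarChordReadSwitches.Touches at htouch
    by_cases ha : I.vars g 2 = I.vars d 2
    · exact ⟨_, I.vars g 3, Or.inl rfl, Or.inl ⟨ha, rfl⟩⟩
    by_cases hb : I.vars g 3 = I.vars d 2
    · exact ⟨_, I.vars g 2, Or.inl rfl, Or.inr ⟨rfl, hb⟩⟩
    by_cases hc : I.vars g 2 = I.vars d 3
    · exact ⟨_, I.vars g 3, Or.inr rfl, Or.inl ⟨hc, rfl⟩⟩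
    by_cases he : I.vars g 3 = I.vars d 3
    · exact ⟨_, I.vars g 2, Or.inr rfl, Or.inr ⟨rfl, he⟩⟩
    exact (htouch ⟨⟨ha, hb⟩, ⟨hc, he⟩⟩).elim
  obtain ⟨v, z, hv, hvz⟩ := slot
  have hzK : ∃ j ∈ K, z ∈ varSet I j := by
    by_contra hz
    push Not at hz
    exact hnogate v z ⟨hv, hvz, hz⟩
  have hvd : v ∈ varSet I d := by rcases hv with rfl | rfl <;> exact vars_mem_varSet I d _
  have hvb : v ∈ bdry I K := by rcases hv with rfl | rfl <;> [exact hch.1; exact hch.2]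
  refine ⟨g, hgM, hgK, ?_, ?_, v, hv, ?_, hvb⟩
  · rcases hvz with ⟨h2, -⟩ | ⟨h2, -⟩
    · exact ⟨d, hd, h2 ▸ hvd⟩
    · rw [h2]; exact hzK
  · rcases hvz with ⟨-, h3⟩ | ⟨-, h3⟩
    · rw [h3]; exact hzK
    · exact ⟨d, hd, h3 ▸ hvd⟩
  · rcases hvz with ⟨h2, -⟩ | ⟨-, h3⟩
    · exact h2 ▸ vars_mem_varSet I g 2
    · exact h3 ▸ vars_mem_varSet I g 3

/-- **An inside monomial reads no AND slot of a clean chord** (typed: its XOR slots hold no AND variable; its AND slots are read by `K`, so it is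
an outside gate on nothing). -/
theorem not_mem_varSet_gate_of_clean (I : LocalMap 4 n m) (hT : Typed I) {K M : Finset (Fin m)} {g : Fin m} (hgM : g ∈ M)
    (hg2 : ∃ j ∈ K, I.vars g 2 ∈ varSet I j) (hg3 : ∃ j ∈ K, I.vars g 3 ∈ varSet I j)
    {c : Fin m} (hO : OutsideGated I K M c) (s : Fin 4) (hs : 2 ≤ s.val) : I.vars c s ∉ varSet I g := by
  intro hmem
  unfold PstarSALevel.varSet at hmem
  obtain ⟨s', -, hs'⟩ := mem_image.1 hmem
  have h4 : ∀ t : Fin 4, 2 ≤ t.val → t = 2 ∨ t = 3 := by decide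
  by_cases hs'2 : 2 ≤ s'.val
  · have hvc : I.vars c s = I.vars c 2 ∨ I.vars c s = I.vars c 3 := by
      rcases h4 s hs with rfl | rfl
      · exact Or.inl rfl
      · exact Or.inr rfl
    have hgs : I.vars g 2 = I.vars c s ∨ I.vars g 3 = I.vars c s := by
      rcases h4 s' hs'2 with rfl | rfl
      · exact Or.inl hs'
      · exact Or.inr hs'
    obtain ⟨v', z', hG⟩ := hO g hgM (touches_of_slot hvc hgs)
    rcases hG.2.1 with ⟨-, h3⟩ | ⟨h2, -⟩
    · obtain ⟨j, hj, hjz⟩ := hg3; exact hG.2.2 j hj (h3 ▸ hjz)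
    · obtain ⟨j, hj, hjz⟩ := hg2; exact hG.2.2 j hj (h2 ▸ hjz)
  · push Not at hs'2
    exact hT g c s' s hs'2 hs hs'

/-- A clean chord of `K` stays a chord of `K + g` for an inside monomial `g`. -/
theorem isChord_insert_of_clean (I : LocalMap 4 n m) (hT : Typed I) {K M : Finset (Fin m)} {g : Fin m} (hgM : g ∈ M) (hgK : g ∉ K)
    (hg2 : ∃ j ∈ K, I.vars g 2 ∈ varSet I j) (hg3 : ∃ j ∈ K, I.vars g 3 ∈ varSet I j)
    {c : Fin m} (hch : IsChord I K c) (hO : OutsideGated I K M c) : IsChord I (insert g K) c := by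
  classical
  have key : ∀ s : Fin 4, 2 ≤ s.val → I.vars c s ∈ bdry I K → I.vars c s ∈ bdry I (insert g K) := by
    intro s hs hb
    rw [mem_bdry_iff] at hb ⊢
    rw [degIn_insert I hgK, if_neg (not_mem_varSet_gate_of_clean I hT hgM hg2 hg3 hO s hs), hb]
  exact ⟨key 2 (by decide) hch.1, key 3 (by decide) hch.2⟩

/-- **Inserting an output that reads TWO distinct boundary variables of `K` (its AND variables read by `K`) does not raise `#bdry`.** -/
theorem card_bdry_insert_le_two (I : LocalMap 4 n m) {K : Finset (Fin m)} {g : Fin m} (hg : g ∉ K)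
    (h2 : ∃ j ∈ K, I.vars g 2 ∈ varSet I j) (h3 : ∃ j ∈ K, I.vars g 3 ∈ varSet I j) {v v' : Fin n} (hvv' : v ≠ v')
    (hv : v ∈ bdry I K) (hvg : v ∈ varSet I g) (hv' : v' ∈ bdry I K) (hv'g : v' ∈ varSet I g) :
    (bdry I (insert g K)).card + 2 ≤ (bdry I K).card + 2 := by
  classical
  have hsub : bdry I (insert g K) ⊆ ((bdry I K).erase v).erase v' ∪ {I.vars g 0, I.vars g 1} := by
    intro u hu
    rw [mem_bdry_iff, degIn_insert I hg] at hu
    rw [mem_union]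
    by_cases hug : u ∈ varSet I g
    · rw [if_pos hug] at hu
      right
      have hK0 : degIn I K u = 0 := by omega
      have hnot : ∀ j ∈ K, u ∉ varSet I j := by
        intro j hj huj
        have : 0 < degIn I K u := by
          unfold PstarSAClosure.degIn; exact card_pos.2 ⟨j, mem_filter.2 ⟨hj, huj⟩⟩
        omega
      unfold PstarSALevel.varSet at hug
      obtain ⟨s, -, hs⟩ := mem_image.1 hug
      have h4 : ∀ t : Fin 4, t = 0 ∨ t = 1 ∨ t = 2 ∨ t = 3 := by decide
      rcases h4 s with rfl | rfl | rfl | rfl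
      · exact mem_insert.2 (Or.inl hs.symm)
      · exact mem_insert_of_mem (mem_singleton.2 hs.symm)
      · obtain ⟨j, hj, hj'⟩ := h2; exact absurd (hs ▸ hj') (hnot j hj)
      · obtain ⟨j, hj, hj'⟩ := h3; exact absurd (hs ▸ hj') (hnot j hj)
    · rw [if_neg hug, add_zero] at hu
      left
      rw [mem_erase, mem_erase, mem_bdry_iff]
      exact ⟨fun h => hug (h ▸ hv'g), fun h => hug (h ▸ hvg), hu⟩
  have h1 := (card_le_card hsub).trans (card_union_le _ _)
  have hve : v' ∈ (bdry I K).erase v := mem_erase.2 ⟨hvv'.symm, hv'⟩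
  have h2' : (((bdry I K).erase v).erase v').card + 1 = ((bdry I K).erase v).card := card_erase_add_one hve
  have h2'' : ((bdry I K).erase v).card + 1 = (bdry I K).card := card_erase_add_one hv
  have h3' : ({I.vars g 0, I.vars g 1} : Finset (Fin n)).card ≤ 2 := card_insert_le _ _ |>.trans (by rw [card_singleton])
  omega

/-! ## The degree-two injection lands in the degree-two vertices off the centre -/

/-- **Refined injection**: in a covered family, the clean chords with a degree-two endpoint inject into the degree-two XOR vertices off any leafless
non-chord set. -/
theorem card_deg2_chords_le_filter (I : LocalMap 4 n m) (hI : I.IsPure xorAndPred) {K M : Finset (Fin m)} (hcov : Covered I K M)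
    {C₂ : Finset (Fin m)} (hC : ∀ c ∈ C₂, c ∈ K ∧ IsChord I K c ∧ OutsideGated I K M c ∧ ∃ w ∈ xpair I c, degIn I K w = 2)
    {S : Finset (Fin m)} (hSK : S ⊆ K) (hSL : ∀ w ∈ xverts I S, 2 ≤ xpdeg I S w) (hSnc : ∀ f ∈ S, ¬ IsChord I K f) :
    C₂.card ≤ ((xverts I K \ xverts I S).filter fun v => degIn I K v = 2).card := by
  classical
  have hdeg2 : ∀ c ∈ C₂, ∃ w ∈ xpair I c, degIn I K w = 2 := fun c hc => (hC c hc).2.2.2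
  choose φ hφx hφd using hdeg2
  have three : ∀ {v : Fin n} {a b c : Fin m}, a ∈ K → b ∈ K → c ∈ K → a ≠ b → a ≠ c → b ≠ c →
      v ∈ varSet I a → v ∈ varSet I b → v ∈ varSet I c → 3 ≤ degIn I K v := by
    intro v a b c ha hb hc hab hac hbc hva hvb hvc
    unfold PstarSAClosure.degIn
    have hsub : ({a, b, c} : Finset (Fin m)) ⊆ K.filter fun j => v ∈ varSet I j := by
      intro j hj
      rw [mem_filter]
      rcases mem_insert.1 hj with rfl | hj
      · exact ⟨ha, hva⟩
      rcases mem_insert.1 hj with rfl | hj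
      · exact ⟨hb, hvb⟩
      · rw [mem_singleton.1 hj]; exact ⟨hc, hvc⟩
    have hcard : ({a, b, c} : Finset (Fin m)).card = 3 := by
      rw [card_insert_of_notMem, card_pair hbc]
      rw [mem_insert, mem_singleton]; push Not; exact ⟨hab, hac⟩
    exact hcard ▸ card_le_card hsub
  have readers : ∀ c (hc : c ∈ C₂), ∀ g ∈ K, φ c hc ∈ xpair I g → g = c ∨ ¬ (IsChord I K g ∧ OutsideGated I K M g) := by
    intro c hc g hg hwg
    by_contra hne
    push Not at hne
    obtain ⟨hgc, hgcl⟩ := hne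
    obtain ⟨hcK, hch, hO, -⟩ := hC c hc
    obtain ⟨f, hf, hwf, hnot⟩ := hcov (φ c hc) ((mem_xverts_iff I K _).2 ⟨c, hcK, hφx c hc⟩)
    have hfc : f ≠ c := fun h => hnot (h ▸ ⟨hch, hO⟩)
    have hfg : f ≠ g := fun h => hnot (h ▸ hgcl)
    have h3 := three hcK hg hf (Ne.symm hgc) hfc.symm hfg.symm (mem_varSet_of_mem_xpair (hφx c hc)) (mem_varSet_of_mem_xpair hwg)
      (mem_varSet_of_mem_xpair hwf)
    have := hφd c hc
    omega
  have havoid : ∀ c (hc : c ∈ C₂), φ c hc ∉ xverts I S := by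
    intro c hc hwS
    have h2 := hSL _ hwS
    obtain ⟨f, hf, -, hwf⟩ := exists_ne_of_two_le_xpdeg I hI c h2
    obtain ⟨f', hf', hf'f, hwf'⟩ := exists_ne_of_two_le_xpdeg I hI f h2
    obtain ⟨hcK, hch, -, -⟩ := hC c hc
    have hfc : f ≠ c := fun h => hSnc f hf (h ▸ hch)
    have hf'c : f' ≠ c := fun h => hSnc f' hf' (h ▸ hch)
    have h3 := three hcK (hSK hf) (hSK hf') hfc.symm hf'c.symm hf'f.symm (mem_varSet_of_mem_xpair (hφx c hc))
      (mem_varSet_of_mem_xpair hwf) (mem_varSet_of_mem_xpair hwf')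
    have := hφd c hc
    omega
  refine card_le_card_of_injOn (fun c => if hc : c ∈ C₂ then φ c hc else I.vars c 0) (fun c hc => ?_) ?_
  · have hc' : c ∈ C₂ := mem_coe.1 hc
    simp only [dif_pos hc']
    rw [mem_coe, mem_filter, mem_sdiff]
    exact ⟨⟨(mem_xverts_iff I K _).2 ⟨c, (hC c hc').1, hφx c hc'⟩, havoid c hc'⟩, hφd c hc'⟩
  · intro c₁ h₁ c₂ h₂ heq
    have h₁' : c₁ ∈ C₂ := mem_coe.1 h₁
    have h₂' : c₂ ∈ C₂ := mem_coe.1 h₂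
    simp only [dif_pos h₁', dif_pos h₂'] at heq
    rcases readers c₁ h₁' c₂ (hC c₂ h₂').1 (heq ▸ hφx c₂ h₂') with h | h
    · exact h.symm
    · exact absurd ⟨(hC c₂ h₂').2.1, (hC c₂ h₂').2.2.1⟩ h

/-! ## Four fat clean chords pairwise meeting at degree-three vertices are impossible -/

/-- **Pigeonhole on fat chords.**  In a covered family, four distinct outside-gated chords of which every two containing a fixed one `c₁` share with
it an endpoint of degree exactly three cannot exist: a degree-three vertex carries a non-clean member, hence at most two clean chords. -/
theorem false_of_four_fat (I : LocalMap 4 n m) {K M : Finset (Fin m)} (hcov : Covered I K M)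
    {c₁ c₂ c₃ c₄ : Fin m} (h₁ : c₁ ∈ K) (h₂ : c₂ ∈ K) (h₃ : c₃ ∈ K) (h₄ : c₄ ∈ K)
    (hcl₁ : IsChord I K c₁ ∧ OutsideGated I K M c₁) (hcl₂ : IsChord I K c₂ ∧ OutsideGated I K M c₂)
    (hcl₃ : IsChord I K c₃ ∧ OutsideGated I K M c₃) (hcl₄ : IsChord I K c₄ ∧ OutsideGated I K M c₄)
    (h21 : c₂ ≠ c₁) (h31 : c₃ ≠ c₁) (h41 : c₄ ≠ c₁) (h32 : c₃ ≠ c₂) (h42 : c₄ ≠ c₂) (h43 : c₄ ≠ c₃)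
    (hx₂ : ∃ w ∈ xpair I c₁, w ∈ xpair I c₂ ∧ degIn I K w = 3) (hx₃ : ∃ w ∈ xpair I c₁, w ∈ xpair I c₃ ∧ degIn I K w = 3)
    (hx₄ : ∃ w ∈ xpair I c₁, w ∈ xpair I c₄ ∧ degIn I K w = 3) : False := by
  classical
  have atmost : ∀ (w : Fin n) (a b c : Fin m), a ∈ K → b ∈ K → c ∈ K →
      (IsChord I K a ∧ OutsideGated I K M a) → (IsChord I K b ∧ OutsideGated I K M b) → (IsChord I K c ∧ OutsideGated I K M c) →
      a ≠ b → a ≠ c → b ≠ c → w ∈ xpair I a → w ∈ xpair I b → w ∈ xpair I c → degIn I K w ≠ 3 := by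
    intro w a b c haK hbK hcK ha hb hc hab hac hbc hwa hwb hwc h3w
    obtain ⟨f, hf, hwf, hnot⟩ := hcov w ((mem_xverts_iff I K w).2 ⟨a, haK, hwa⟩)
    have hfa : f ≠ a := fun h => hnot (h ▸ ha)
    have hfb : f ≠ b := fun h => hnot (h ▸ hb)
    have hfc : f ≠ c := fun h => hnot (h ▸ hc)
    have hsub : ({a, b, c, f} : Finset (Fin m)) ⊆ K.filter fun j => w ∈ varSet I j := by
      intro j hj
      rw [mem_filter]
      rcases mem_insert.1 hj with rfl | hj
      · exact ⟨haK, mem_varSet_of_mem_xpair hwa⟩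
      rcases mem_insert.1 hj with rfl | hj
      · exact ⟨hbK, mem_varSet_of_mem_xpair hwb⟩
      rcases mem_insert.1 hj with rfl | hj
      · exact ⟨hcK, mem_varSet_of_mem_xpair hwc⟩
      · rw [mem_singleton.1 hj]; exact ⟨hf, mem_varSet_of_mem_xpair hwf⟩
    have hcard : ({a, b, c, f} : Finset (Fin m)).card = 4 := by
      rw [card_insert_of_notMem, card_insert_of_notMem, card_pair hfc.symm]
      · rw [mem_insert, mem_singleton]; push Not; exact ⟨hbc, hfb.symm⟩
      · rw [mem_insert, mem_insert, mem_singleton]; push Not; exact ⟨hab, hac, hfa.symm⟩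
    have := hcard ▸ card_le_card hsub
    unfold PstarSAClosure.degIn at h3w
    omega
  obtain ⟨x₂, hx₂1, hx₂2, hd₂⟩ := hx₂
  obtain ⟨x₃, hx₃1, hx₃3, hd₃⟩ := hx₃
  obtain ⟨x₄, hx₄1, hx₄4, hd₄⟩ := hx₄
  have two : ∀ u v w : Fin n, u ∈ xpair I c₁ → v ∈ xpair I c₁ → w ∈ xpair I c₁ → u = v ∨ u = w ∨ v = w := by
    intro u v w hu hv hw
    rcases (mem_xpair I).1 hu with rfl | rfl <;> rcases (mem_xpair I).1 hv with rfl | rfl <;>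
      rcases (mem_xpair I).1 hw with h | h <;> simp [h]
  rcases two x₂ x₃ x₄ hx₂1 hx₃1 hx₄1 with h | h | h
  · exact atmost x₂ c₁ c₂ c₃ h₁ h₂ h₃ hcl₁ hcl₂ hcl₃ h21.symm h31.symm h32.symm hx₂1 hx₂2 (h ▸ hx₃3) hd₂
  · exact atmost x₂ c₁ c₂ c₄ h₁ h₂ h₄ hcl₁ hcl₂ hcl₄ h21.symm h41.symm h42.symm hx₂1 hx₂2 (h ▸ hx₄4) hd₂
  · exact atmost x₃ c₁ c₃ c₄ h₁ h₃ h₄ hcl₁ hcl₃ hcl₄ h31.symm h41.symm h43.symm hx₃1 hx₃3 (h ▸ hx₄4) hd₃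

/-! ## At most three members on three vertices -/

/-- **On a simple-overlap pure instance at most three members of a family have both XOR variables in a given set of three vertices** (distinct
members have distinct XOR pairs). -/
theorem card_le_three_of_xpairs_subset (I : LocalMap 4 n m) (hI : I.IsPure xorAndPred) (hS : SimpleOverlap I) {T : Finset (Fin m)}
    {V : Finset (Fin n)} (hV : V.card = 3) (hT : ∀ j ∈ T, xpair I j ⊆ V) : T.card ≤ 3 := by
  classical
  have h01 : ∀ j : Fin m, I.vars j 0 ≠ I.vars j 1 := fun j h => absurd (hI.2 j h) (by decide)
  have hpair : ∀ j, (xpair I j).card = 2 := fun j => by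
    unfold PstarXCore.xpair; exact card_pair (h01 j)
  have hmaps : Set.MapsTo (fun j => xpair I j) (T : Set (Fin m)) ((V.powersetCard 2 : Finset (Finset (Fin n))) : Set (Finset (Fin n))) := by
    intro j hj
    rw [mem_coe, mem_powersetCard]
    exact ⟨hT j (mem_coe.1 hj), hpair j⟩
  have hinj : Set.InjOn (fun j => xpair I j) (T : Set (Fin m)) := by
    intro j hj j' hj' heq
    change xpair I j = xpair I j' at heq
    by_contra hne
    have h2 : xpair I j ⊆ varSet I j ∩ varSet I j' := by
      intro v hv
      rw [mem_inter]
      have hv' : v ∈ xpair I j' := heq ▸ hv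
      exact ⟨mem_varSet_of_mem_xpair hv, mem_varSet_of_mem_xpair hv'⟩
    have := (card_le_card h2).trans (hS j j' hne)
    rw [hpair j] at this
    omega
  have h := card_le_card_of_injOn _ hmaps hinj
  rw [card_powersetCard, hV] at h
  exact h

end Summit.PneNP.PneNP.Theorems.PstarSlackTwoTools
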